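import Summits.BirchSwinnertonDyer.BirchSwinnertonDyer.Theorems.Rank2ShaTierKitW16
import Summits.BirchSwinnertonDyer.BirchSwinnertonDyer.Theorems.Rank2ObservatoryTangentCert
import Summits.BirchSwinnertonDyer.BirchSwinnertonDyer.Theorems.Rank2ObservatoryKernelWalkerT
import Summits.BirchSwinnertonDyer.BirchSwinnertonDyer.Theorems.Rank2ObservatoryTorsionCertA
import Summits.BirchSwinnertonDyer.Rank1Residual.Additive.LocalTorsionExponent
import Literature.NumberTheory.EllipticCurves.TamagawaProofs
import Literature.NumberTheory.EllipticCurves.MazurTorsionGaloisStructureProofs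
import HarnessLib

/-!
# BirchSwinnertonDyer — rank-2 `Ш[5^∞]` cell: frame «w16-bound» for rows with a RATIONAL POINT OF
# ORDER `p = 5` (reducible `E[5]`, torsion term `2·ord_5 #E(ℚ)_tors = 2` certified TWO-SIDED in the kernel)

HONEST FRAMING (cell `b2b-bsdr2sha`, run/shared/lean/b2b/bsd-rank2-sha/): per-pair certified
theorems «cited hypotheses ∧ certified computation ⇒ `Ш(E/ℚ)[p^∞]` finite of order dividing `p^k`»
for rank-2 curves at good ordinary primes; NO claim on BSD in rank `≥ 2`, no class-level theorem,
every published input is a NAMED HYPOTHESIS of the tree (nothing is asserted or minted here).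

Cell ruling (47)(a) (12 census cells, `E(ℚ)_tors ≅ ℤ/5`, `p = 5`). Wuthrich 2014 Thm. 16 (named fact
`hW16`) bounds `ord_5 #Ш` with the torsion term `2·ord_5 #E(ℚ)_tors` LIVE. Everything curve-side is
decided in the kernel, WITHOUT a named torsion theorem (no Mazur, no Weil pairing):
* `fiveTorsCheck e x₁ y₁ x₂ y₂` — integral points `T = (x₁, y₁)`, `2T = (x₂, y₂)` on the integer
  model with two tangent certificates (`intTangent`, Silverman AEC III.2.3): `T + T = 2T` and
  `2T + 2T = −T`; hence `5 • T = 0`, `T ≠ 0`, `addOrderOf T = 5`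
  (`exists_addOrderOf_eq_five_of_fiveTorsCheck`), so `E[5]` is REDUCIBLE
  (`MazurTorsionGaloisStructureProofs.not_hasIrreducibleModPGaloisRep_of_addOrderOf_eq`) and
  `5 ∣ #E(ℚ)_tors` (Lagrange in the finite torsion subgroup);
* `torsBoundCheck e p ℓ sq n` — a good odd prime `ℓ` with `#Ẽ(𝔽_ℓ) = n`, `p² ∤ n`: then
  `ord_p #E(ℚ)_tors ≤ ord_p (c_ℓ · #Ẽ(𝔽_ℓ)) = ord_p #Ẽ(𝔽_ℓ) ≤ 1`, because `E(ℚ)_tors` embeds in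
  `E(ℚ_ℓ)_tors` (base change is injective) whose order divides `c_ℓ · #Ẽ_ns(𝔽_ℓ)` at any `ℓ ≥ 3`
  (sibling theorem `LocalLog.card_torsion_baseChange_dvd`, Silverman AEC VII.3.1) and `c_ℓ = 1` at good
  reduction (`localTamagawaNumber_eq_one_of_hasGoodReduction_holds`) —
  `padicValNat_torsionOrder_le_of_torsBoundCheck`; with the point of order `p`: `ord_p #E(ℚ)_tors = 1`;
* `ShaRow.checkWP := check ∧ (R.p = 5) ∧ fiveTorsCheck ∧ torsBoundCheck`, read off the `SurjWitness` slots
  `x₁ = l₁ − sq₁`, `y₁ = n₁ − w₁`, `x₂ = l₂ − sq₂`, `y₂ = n₂ − l₃`, `(ℓ, ⌊√ℓ⌋, n) = (sq₃, n₃, u)`;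
* `ShaRow.w16P` — `ord_5 #Ш(E/ℚ)[5^∞] ≤ R.k + 2`; `w16P_eq_one` (`R.k + 2 ≤ 0`); READERS
  `booked_w16POne` (certificate `R.checkWP = true ∧ R.k + 2 ≤ 0 ∧ 2 ≤ rank`) and `booked_w16PLe`,
  binders as in every w16 reader: `hW16`, `hS`, `h26`, the EXPLICIT optimal datum, L-datum, height datum.

References: C. Wuthrich, Doc. Math. 19 (2014), Thm. 16 [Wuthrich2014]; A. Agashe, K. Ribet, W. Stein,
PAMQ 2 (2006), Thm. 2.6 [AgasheRibetStein2006]; J. H. Silverman, AEC (2009), III.2.3, VII.3.1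
[SilvermanAEC2009]; B. Mazur, IHÉS 47 (1977), Ch. III §5 p. 157 [Mazur1977]; W. Stein, C. Wuthrich,
Math. Comp. 82 (2013), Alg. 11.1 [SteinWuthrich2013].
-/

set_option autoImplicit false

-- single-conjunct summit: `Summit.BirchSwinnertonDyer.BirchSwinnertonDyer.…` repeats the name by design
set_option linter.dupNamespace false

noncomputable section

open scoped Classical MatrixGroups ModularForm

open CongruenceSubgroup WeierstrassCurve Literature.NumberTheory.EllipticCurves
  Literature.NumberTheory.EllipticCurves.ModularForms
  Literature.NumberTheory.EllipticCurves.Rank1Residual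
  Summit.BirchSwinnertonDyer.BirchSwinnertonDyer.Rank2Observatory

namespace Summit.BirchSwinnertonDyer.BirchSwinnertonDyer.Rank2Sha

/-! ## §1. A rational point of order `5` from two tangent certificates -/

/-- **Kernel certificate of a rational point of order `5`** on an integer model: `T = (x₁, y₁)` and
`2T = (x₂, y₂)` integral points with the tangent certificates `T + T = (x₂, y₂)` and
`2T + 2T = (x₁, −y₁ − a₁x₁ − a₃) = −T`. [cite: SilvermanAEC2009, III.2.3] -/
def fiveTorsCheck (e : WeierstrassCurve ℤ) (x₁ y₁ x₂ y₂ : ℤ) : Bool :=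
  onCurveZ e x₁ y₁ && onCurveZ e x₂ y₂ && intTangent e x₁ y₁ x₂ y₂ &&
    intTangent e x₂ y₂ x₁ (-y₁ - e.a₁ * x₁ - e.a₃)

/-- **Soundness**: a passing `fiveTorsCheck` (and `Δ ≠ 0`) gives a rational point of order exactly `5`.
[cite: SilvermanAEC2009, III.2.3] -/
theorem exists_addOrderOf_eq_five_of_fiveTorsCheck {e : WeierstrassCurve ℤ} {x₁ y₁ x₂ y₂ : ℤ}
    (hΔ : e.Δ ≠ 0) (h : fiveTorsCheck e x₁ y₁ x₂ y₂ = true) :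
    ∃ T : (e.map (Int.castRingHom ℚ)).toAffine.Point, addOrderOf T = 5 := by
  simp only [fiveTorsCheck, Bool.and_eq_true] at h
  obtain ⟨⟨⟨h₁, h₂⟩, ht₁⟩, ht₂⟩ := h
  have h₁' := onCurveZ_spec e h₁
  have h₂' := onCurveZ_spec e h₂
  have hneg : (-y₁ - e.a₁ * x₁ - e.a₃) ^ 2 + e.a₁ * x₁ * (-y₁ - e.a₁ * x₁ - e.a₃) +
      e.a₃ * (-y₁ - e.a₁ * x₁ - e.a₃) = x₁ ^ 3 + e.a₂ * x₁ ^ 2 + e.a₄ * x₁ + e.a₆ := by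
    linear_combination h₁'
  haveI := isElliptic_rat e hΔ
  haveI : Fact (Nat.Prime 5) := ⟨by norm_num⟩
  set T : (e.map (Int.castRingHom ℚ)).toAffine.Point :=
    .some _ _ (nonsingular_rat_of_eq e hΔ h₁') with hT
  have hdbl₁ := some_add_self_of_intTangent e hΔ h₁' h₂' ht₁
  have hdbl₂ := some_add_self_of_intTangent e hΔ h₂' hneg ht₂
  have hnegT : -T = .some ((x₁ : ℤ) : ℚ) ((-y₁ - e.a₁ * x₁ - e.a₃ : ℤ) : ℚ)
      (nonsingular_rat_of_eq e hΔ hneg) := by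
    rw [hT, Affine.Point.neg_some]
    congr 1
    simp only [Affine.negY, WeierstrassCurve.map, eq_intCast]
    push_cast; ring
  have h2 : (2 : ℕ) • T = .some _ _ (nonsingular_rat_of_eq e hΔ h₂') := by
    rw [two_nsmul]; exact hdbl₁
  have h4 : (4 : ℕ) • T = -T := by
    rw [show (4 : ℕ) = 2 * 2 from rfl, mul_nsmul', h2, two_nsmul, hnegT]; exact hdbl₂
  have h5 : (5 : ℕ) • T = 0 := by
    rw [show (5 : ℕ) = 4 + 1 from rfl, add_nsmul, h4, one_nsmul, neg_add_cancel]
  exact ⟨T, addOrderOf_eq_prime h5 (Affine.Point.some_ne_zero _)⟩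

/-! ## §2. The kernel upper bound on `ord_p #E(ℚ)_tors` at a good prime -/

/-- **`ord_p #E(ℚ)_tors ≤ ord_p #Ẽ(𝔽_ℓ)` at a good prime `ℓ ≥ 3`** (no named fact): `E(ℚ)_tors` embeds in
`E(ℚ_ℓ)_tors` (base change of points is injective), whose order divides `c_ℓ · #Ẽ_ns(𝔽_ℓ)` for every
`ℓ ≥ 3` (the kernel of reduction is torsion-free; sibling theorem `LocalLog.card_torsion_baseChange_dvd`),
and `c_ℓ = 1` at good reduction. [cite: SilvermanAEC2009, VII.3.1(b) and VII.2.1] -/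
theorem padicValNat_torsionOrder_le_of_good (W : WeierstrassCurve ℚ) [W.IsElliptic]
    [W.IsGloballyMinimal] (p ℓ : ℕ) [Fact p.Prime] [Fact ℓ.Prime] (h3 : 3 ≤ ℓ)
    (hgood : W.HasGoodReductionAtPrime ℓ) :
    padicValNat p W.torsionOrder ≤ padicValNat p (W.reductionPointCount ℓ) := by
  -- `#E(ℚ)_tors ∣ #E(ℚ_ℓ)_tors`
  let ι : W.toAffine.Point →+ (W.baseChange ℚ_[ℓ]).toAffine.Point :=
    Affine.Point.baseChange (W' := W.toAffine) ℚ ℚ_[ℓ]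
  have hι : Function.Injective ι := Affine.Point.map_injective _
  have hle : AddCommGroup.torsion W.toAffine.Point ≤
      (AddCommGroup.torsion (W.baseChange ℚ_[ℓ]).toAffine.Point).comap ι := by
    intro x hx
    rw [AddSubgroup.mem_comap, AddCommGroup.mem_torsion]
    exact ι.isOfFinAddOrder ((AddCommGroup.mem_torsion _).mp hx)
  have hd1 : Nat.card (AddCommGroup.torsion W.toAffine.Point) ∣
      Nat.card (AddCommGroup.torsion (W.baseChange ℚ_[ℓ]).toAffine.Point) :=
    (AddSubgroup.card_dvd_of_le hle).trans (AddSubgroup.card_comap_dvd_of_injective _ ι hι)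
  -- `#E(ℚ_ℓ)_tors ∣ c_ℓ · #Ẽ(𝔽_ℓ)` and `c_ℓ = 1`
  have hd2 := Summit.BirchSwinnertonDyer.Rank1Residual.Additive.LocalLog.card_torsion_baseChange_dvd W ℓ h3
  have hc : (W.baseChange ℚ_[ℓ]).localTamagawaNumber ℤ_[ℓ] = 1 := by
    haveI : ((W.baseChange ℚ_[ℓ]).minimal ℤ_[ℓ]).HasGoodReduction ℤ_[ℓ] := hgood
    exact localTamagawaNumber_eq_one_of_hasGoodReduction_holds ℤ_[ℓ] (W.baseChange ℚ_[ℓ])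
  rw [hc, one_mul] at hd2
  have hd : W.torsionOrder ∣ W.reductionPointCount ℓ := by
    rw [torsionOrder_eq_natCard]; exact hd1.trans hd2
  have hN0 : W.reductionPointCount ℓ ≠ 0 := (W.reductionPointCount_pos ℓ).ne'
  exact (padicValNat_dvd_iff_le hN0).mp (pow_padicValNat_dvd.trans hd)

/-- **Kernel certificate bounding `ord_p #E(ℚ)_tors` by `1`**: a good odd prime `ℓ` (trial division
datum `sq = ⌊√ℓ⌋`) with `ℓ ∤ Δ`, kernel point count `#Ẽ(𝔽_ℓ) = n` and `p² ∤ n`. [cite: SilvermanAEC2009, VII.3.1(b)] -/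
def torsBoundCheck (e : WeierstrassCurve ℤ) (p ℓ sq n : ℕ) : Bool :=
  Tam.TamLocal.primeB ℓ sq && decide (ℓ ≠ 2) && decide (¬ ((ℓ : ℤ) ∣ e.Δ)) &&
    decide (curveCount ℓ e = n) && decide (¬ (p ^ 2 ∣ n))

/-- **Soundness of `torsBoundCheck`**: `ord_p #E(ℚ)_tors ≤ 1`. [cite: SilvermanAEC2009, VII.3.1(b)] -/
theorem padicValNat_torsionOrder_le_one_of_torsBoundCheck {e : WeierstrassCurve ℤ} {p ℓ sq n : ℕ}
    (h : torsBoundCheck e p ℓ sq n = true) [Fact p.Prime] [(e.baseChange ℚ).IsElliptic]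
    [(e.baseChange ℚ).IsGloballyMinimal] : padicValNat p (e.baseChange ℚ).torsionOrder ≤ 1 := by
  simp only [torsBoundCheck, Bool.and_eq_true, decide_eq_true_eq] at h
  obtain ⟨⟨⟨⟨hP, h2⟩, hΔ⟩, hN⟩, hpn⟩ := h
  have hℓ : ℓ.Prime := Tam.TamLocal.prime_of_primeB hP
  haveI : Fact ℓ.Prime := ⟨hℓ⟩
  have h3 : 3 ≤ ℓ := by have := hℓ.two_le; omega
  have hgood : (e.baseChange ℚ).HasGoodReductionAtPrime ℓ :=
    hasGoodReductionAtPrime_of_not_dvd _ ℓ (by rw [minimalDiscriminantInt_baseChange_int]; exact hΔ)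
  have hle := padicValNat_torsionOrder_le_of_good (e.baseChange ℚ) p ℓ h3 hgood
  rw [reductionPointCount_baseChange_int, card_eq_curveCount ℓ h2 e hΔ, hN] at hle
  have hn0 : n ≠ 0 := by rintro rfl; exact hpn (dvd_zero _)
  have hv : padicValNat p n ≤ 1 := by
    by_contra hv
    exact hpn ((padicValNat_dvd_iff_le hn0).mpr (by omega))
  exact hle.trans hv

/-! ## §3. The compact row with a point of order `5` -/

namespace ShaRow

variable (R : ShaRow)

/-- **The kernel test of a `p = 5` row of frame «w16-bound» with a rational point of order `5`**: the base
test (`p ≥ 5` good ordinary, minimal model, exact Tamagawa certificate), `R.p = 5`, the order-`5`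
certificate `fiveTorsCheck` on `T = (l₁ − sq₁, n₁ − w₁)`, `2T = (l₂ − sq₂, n₂ − l₃)` and the torsion bound
`torsBoundCheck` at `(ℓ, ⌊√ℓ⌋, n) = (sq₃, n₃, u)` (slots of `R.sw`). [cite: Wuthrich2014, Thm. 16 (p. 397)]
[cite: SilvermanAEC2009, III.2.3 and VII.3.1(b)] -/
def checkWP : Bool :=
  R.check && decide (R.p = 5) &&
    fiveTorsCheck R.e ((R.sw.l₁ : ℤ) - R.sw.sq₁) ((R.sw.n₁ : ℤ) - R.sw.w₁) ((R.sw.l₂ : ℤ) - R.sw.sq₂)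
      ((R.sw.n₂ : ℤ) - R.sw.l₃) &&
    torsBoundCheck R.e R.p R.sw.sq₃ R.sw.n₃ R.sw.u

variable {R}

/-- A row passing `checkWP` passes the base test. [folklore] -/
theorem check_of_checkWP (h : R.checkWP = true) : R.check = true := by
  simp only [checkWP, Bool.and_eq_true] at h; exact h.1.1.1

/-- Unpacking `checkWP`. [folklore] -/
theorem checkWP_spec (h : R.checkWP = true) :
    R.check = true ∧ R.p = 5 ∧
      fiveTorsCheck R.e ((R.sw.l₁ : ℤ) - R.sw.sq₁) ((R.sw.n₁ : ℤ) - R.sw.w₁) ((R.sw.l₂ : ℤ) - R.sw.sq₂)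
        ((R.sw.n₂ : ℤ) - R.sw.l₃) = true ∧
      torsBoundCheck R.e R.p R.sw.sq₃ R.sw.n₃ R.sw.u = true := by
  simp only [checkWP, Bool.and_eq_true, decide_eq_true_eq] at h
  obtain ⟨⟨⟨hc, hp⟩, hf⟩, ht⟩ := h
  exact ⟨hc, hp, hf, ht⟩

/-- From a tier theorem `rows.all checkWP = true` to the test of a member. [folklore] -/
theorem checkWP_of_all {rows : List ShaRow} (hall : rows.all ShaRow.checkWP = true) {R : ShaRow}
    (hmem : R ∈ rows) : R.checkWP = true :=
  List.all_eq_true.mp hall R hmem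

/-- At a row passing `checkWP`: `E[p]` is REDUCIBLE and `ord_p #E(ℚ)_tors = 1` (both in the kernel).
[cite: Mazur1977, Ch. III §5, p. 157] [cite: SilvermanAEC2009, III.2.3 and VII.3.1(b)] -/
theorem red_and_padicValNat_torsionOrder_of_checkWP (h : R.checkWP = true) [Fact R.p.Prime]
    [(R.e.baseChange ℚ).IsElliptic] [(R.e.baseChange ℚ).IsGloballyMinimal] :
    ¬ (R.e.baseChange ℚ).HasIrreducibleModPGaloisRep R.p ∧
      padicValNat R.p (R.e.baseChange ℚ).torsionOrder = 1 := by
  obtain ⟨hc, hp5, hf, ht⟩ := checkWP_spec h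
  have hΔ : R.e.Δ ≠ 0 := fun h0 => (check_spec hc).2.2.1 (by rw [h0]; exact dvd_zero _)
  obtain ⟨T₀, hT₀⟩ := exists_addOrderOf_eq_five_of_fiveTorsCheck hΔ hf
  -- the same point on `R.e ⊗ ℚ` (`baseChange ℚ = map (algebraMap ℤ ℚ)`, definitionally `map (Int.castRingHom ℚ)`)
  let T : (R.e.baseChange ℚ).toAffine.Point := T₀
  have hT' : addOrderOf T = R.p := by rw [hp5]; exact hT₀
  refine ⟨not_hasIrreducibleModPGaloisRep_of_addOrderOf_eq (R.e.baseChange ℚ) hT', le_antisymm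
    (padicValNat_torsionOrder_le_one_of_torsBoundCheck ht) ?_⟩
  -- `p ∣ #E(ℚ)_tors` from the point of order `p`
  have hfin : IsOfFinAddOrder T := addOrderOf_pos_iff.mp (by rw [hT']; exact (Fact.out : R.p.Prime).pos)
  have hdvd : R.p ∣ (R.e.baseChange ℚ).torsionOrder := by
    rw [torsionOrder_eq_natCard, ← hT']
    have := addOrderOf_dvd_natCard (⟨T, (AddCommGroup.mem_torsion _).mpr hfin⟩ :
      AddCommGroup.torsion (R.e.baseChange ℚ).toAffine.Point)
    rwa [AddSubgroup.addOrderOf_mk] at this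
  have h0 : (R.e.baseChange ℚ).torsionOrder ≠ 0 :=
    ((R.e.baseChange ℚ).torsionOrder_pos_holds).ne'
  exact (padicValNat_dvd_iff_le h0).mp (by rw [pow_one]; exact hdvd)

/-- **TIER ROW THEOREM, frame «w16-bound», rational point of order `p = 5`.** For a compact row `R`
passing `checkWP` (kernel: `p = 5` good ordinary, minimal model, exact Tamagawa certificate, a rational
point of order `5` — so `E[5]` is reducible —, and `ord_5 #E(ℚ)_tors = 1` two-sided), GIVEN `hW16`
(Wuthrich 2014 Thm. 16), `hS` (PRS), `h26` (Agashe–Ribet–Stein Thm. 2.6), an EXPLICIT lattice-optimal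
parametrisation datum at a level `N ≤ 130000`, the rank certificate, the L-datum and THE canonical height
datum: `rank_ℤ E(ℚ) = 2`, `Ш(E/ℚ)[5^∞]` finite, `Reg_5 ≠ 0`, `ord_5 #Ш(E/ℚ)[5^∞] ≤ R.k + 2` (the torsion
term `2·ord_5 #E(ℚ)_tors = 2`). Per pair; NOT a class theorem. [cite: Wuthrich2014, Thm. 16 (p. 397)]
[cite: AgasheRibetStein2006, Thm. 2.6] [cite: BalakrishnanMullerStein2015, Thm. 1.7]
[cite: SteinWuthrich2013, §§3–4 and Alg. 11.1] -/
theorem w16P (h : R.checkWP = true) [Fact R.p.Prime] [(R.e.baseChange ℚ).IsElliptic]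
    [(R.e.baseChange ℚ).IsGloballyMinimal]
    (hW16 : Wuthrich2014.charIdeal_dvd_padicLFunction) (hS : Schneider1985_order_charGenerator_odd)
    (h26 : AgasheRibetStein2006.cremona_abs_maninConstant_eq_one_of_level_le)
    {N : ℕ} [NeZero N] (D : ModularParametrizationData (R.e.baseChange ℚ) N)
    (hopt : ∀ z ∈ D.L.lattice, ∃ w ∈ periodLattice D.f, z = D.c * w) (hN : N ≤ 130000)
    (hlow : 2 ≤ (R.e.baseChange ℚ).mordellWeilRank)
    (hLp : PowerSeries.coeff 2 (padicLFunction D.f (unitRoot (R.e.baseChange ℚ) R.p : ℚ_[R.p])) ≠ 0)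
    (hcoeff : (PowerSeries.coeff 2
      (padicLFunction D.f (unitRoot (R.e.baseChange ℚ) R.p : ℚ_[R.p]))).valuation = R.a)
    (Dh : PAdicHeightData (R.e.baseChange ℚ) R.p) (hDh : Dh.IsCanonical)
    (hreg : (padicRegulator Dh).valuation = R.b) :
    (R.e.baseChange ℚ).mordellWeilRank = 2 ∧
      Finite (AddCommGroup.primaryComponent (R.e.baseChange ℚ).sha R.p) ∧ SchneiderConjecture Dh ∧
      (padicValNat R.p (Nat.card (AddCommGroup.primaryComponent (R.e.baseChange ℚ).sha R.p)) : ℤ) ≤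
        R.k + 2 := by
  have hb := check_of_checkWP h
  have hp2 : R.p ≠ 2 := by have := five_le_of_check hb; omega
  have hordin := isOrdinaryAt_of_check hb
  obtain ⟨hred, htors⟩ := red_and_padicValNat_torsionOrder_of_checkWP h
  obtain ⟨hr, hfin, hSch, hle⟩ := padicBSD_inequality_of_wuthrich16_odd_of_coeff_ne_zero_of_optimal
    hW16 hS h26 (R.e.baseChange ℚ) R.p hp2 hordin.1 hordin.2 hred D hopt hN Dh hDh hlow hLp
  haveI := hfin
  refine ⟨hr, hfin, hSch, ?_⟩
  have hk := padicValNat_card_shaPrimary_le_of_valuation_le (R.e.baseChange ℚ) R.p hp2 hordin D.f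
    Dh hSch hLp hle hcoeff hreg
  rw [htors, reductionPointCount_eq hb, tamagawaProduct_eq hb] at hk
  rw [ShaRow.k]
  push_cast at hk ⊢
  linarith

/-- **Frame «w16-bound» with a point of order `5`, `R.k + 2 ≤ 0`: `Ш(E/ℚ)[5^∞] = 0`.**
[cite: Wuthrich2014, Thm. 16 (p. 397)] [cite: SteinWuthrich2013, Thm. 1.1 and Alg. 11.1] -/
theorem w16P_eq_one (h : R.checkWP = true) [Fact R.p.Prime] [(R.e.baseChange ℚ).IsElliptic]
    [(R.e.baseChange ℚ).IsGloballyMinimal]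
    (hW16 : Wuthrich2014.charIdeal_dvd_padicLFunction) (hS : Schneider1985_order_charGenerator_odd)
    (h26 : AgasheRibetStein2006.cremona_abs_maninConstant_eq_one_of_level_le)
    {N : ℕ} [NeZero N] (D : ModularParametrizationData (R.e.baseChange ℚ) N)
    (hopt : ∀ z ∈ D.L.lattice, ∃ w ∈ periodLattice D.f, z = D.c * w) (hN : N ≤ 130000)
    (hlow : 2 ≤ (R.e.baseChange ℚ).mordellWeilRank)
    (hLp : PowerSeries.coeff 2 (padicLFunction D.f (unitRoot (R.e.baseChange ℚ) R.p : ℚ_[R.p])) ≠ 0)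
    (hcoeff : (PowerSeries.coeff 2
      (padicLFunction D.f (unitRoot (R.e.baseChange ℚ) R.p : ℚ_[R.p]))).valuation = R.a)
    (Dh : PAdicHeightData (R.e.baseChange ℚ) R.p) (hDh : Dh.IsCanonical)
    (hreg : (padicRegulator Dh).valuation = R.b) (hk0 : R.k + 2 ≤ 0) :
    (R.e.baseChange ℚ).mordellWeilRank = 2 ∧
      Finite (AddCommGroup.primaryComponent (R.e.baseChange ℚ).sha R.p) ∧ SchneiderConjecture Dh ∧
      Nat.card (AddCommGroup.primaryComponent (R.e.baseChange ℚ).sha R.p) = 1 := by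
  obtain ⟨hr, hfin, hSch, hle⟩ := w16P h hW16 hS h26 D hopt hN hlow hLp hcoeff Dh hDh hreg
  haveI := hfin
  have hv0 : padicValNat R.p (Nat.card (AddCommGroup.primaryComponent (R.e.baseChange ℚ).sha R.p)) = 0 := by
    have := hle.trans hk0
    omega
  have hndvd : ¬ R.p ∣ Nat.card (AddCommGroup.primaryComponent (R.e.baseChange ℚ).sha R.p) := by
    rcases padicValNat.eq_zero_iff.mp hv0 with h1 | h0 | hnd
    · exact absurd h1 (Fact.out : R.p.Prime).one_lt.ne'
    · exact absurd h0 Nat.card_pos.ne'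
    · exact hnd
  exact ⟨hr, hfin, hSch, natCard_primaryComponent_eq_one R.p hndvd⟩

/-- **READER, frame «w16-bound» with a point of order `5`, V-BOUND 0** («`Ш(E/ℚ)[5^∞] = 0`»): certificate
`R.checkWP = true ∧ R.k + 2 ≤ 0 ∧ 2 ≤ rank`. [cite: Wuthrich2014, Thm. 16 (p. 397)] [cite: AgasheRibetStein2006, Thm. 2.6]
[cite: SteinWuthrich2013, Alg. 11.1 and Prop. 11.2] -/
theorem booked_w16POne (h : R.checkWP = true ∧ R.k + 2 ≤ 0 ∧ 2 ≤ (R.e.baseChange ℚ).mordellWeilRank) :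
    haveI : Fact R.p.Prime := ⟨prime_of_check (check_of_checkWP h.1)⟩
    haveI := isElliptic (check_of_checkWP h.1)
    haveI := isGloballyMinimal (check_of_checkWP h.1)
    ∀ (_hW16 : Wuthrich2014.charIdeal_dvd_padicLFunction) (_hS : Schneider1985_order_charGenerator_odd)
      (_h26 : AgasheRibetStein2006.cremona_abs_maninConstant_eq_one_of_level_le)
      {N : ℕ} [NeZero N] (D : ModularParametrizationData (R.e.baseChange ℚ) N)
      (_hopt : ∀ z ∈ D.L.lattice, ∃ w ∈ periodLattice D.f, z = D.c * w) (_hN : N ≤ 130000)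
      (_hLp : PowerSeries.coeff 2 (padicLFunction D.f (unitRoot (R.e.baseChange ℚ) R.p : ℚ_[R.p])) ≠ 0)
      (_hcoeff : (PowerSeries.coeff 2
        (padicLFunction D.f (unitRoot (R.e.baseChange ℚ) R.p : ℚ_[R.p]))).valuation = R.a)
      (Dh : PAdicHeightData (R.e.baseChange ℚ) R.p) (_hDh : Dh.IsCanonical)
      (_hreg : (padicRegulator Dh).valuation = R.b),
      (R.e.baseChange ℚ).mordellWeilRank = 2 ∧
        Finite (AddCommGroup.primaryComponent (R.e.baseChange ℚ).sha R.p) ∧ SchneiderConjecture Dh ∧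
        Nat.card (AddCommGroup.primaryComponent (R.e.baseChange ℚ).sha R.p) = 1 := by
  intro hW16 hS h26 N _ D hopt hN hLp hcoeff Dh hDh hreg
  haveI : Fact R.p.Prime := ⟨prime_of_check (check_of_checkWP h.1)⟩
  haveI := isElliptic (check_of_checkWP h.1)
  haveI := isGloballyMinimal (check_of_checkWP h.1)
  exact w16P_eq_one h.1 hW16 hS h26 D hopt hN h.2.2 hLp hcoeff Dh hDh hreg h.2.1

/-- **READER, frame «w16-bound» with a point of order `5`, V-BOUND `b`**: certificate `R.checkWP = true ∧
2 ≤ rank`; conclusion `ord_5 #Ш(E/ℚ)[5^∞] ≤ R.k + 2`. [cite: Wuthrich2014, Thm. 16 (p. 397)]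
[cite: AgasheRibetStein2006, Thm. 2.6] [cite: SteinWuthrich2013, Alg. 11.1 and Prop. 11.2] -/
theorem booked_w16PLe (h : R.checkWP = true ∧ 2 ≤ (R.e.baseChange ℚ).mordellWeilRank) :
    haveI : Fact R.p.Prime := ⟨prime_of_check (check_of_checkWP h.1)⟩
    haveI := isElliptic (check_of_checkWP h.1)
    haveI := isGloballyMinimal (check_of_checkWP h.1)
    ∀ (_hW16 : Wuthrich2014.charIdeal_dvd_padicLFunction) (_hS : Schneider1985_order_charGenerator_odd)
      (_h26 : AgasheRibetStein2006.cremona_abs_maninConstant_eq_one_of_level_le)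
      {N : ℕ} [NeZero N] (D : ModularParametrizationData (R.e.baseChange ℚ) N)
      (_hopt : ∀ z ∈ D.L.lattice, ∃ w ∈ periodLattice D.f, z = D.c * w) (_hN : N ≤ 130000)
      (_hLp : PowerSeries.coeff 2 (padicLFunction D.f (unitRoot (R.e.baseChange ℚ) R.p : ℚ_[R.p])) ≠ 0)
      (_hcoeff : (PowerSeries.coeff 2
        (padicLFunction D.f (unitRoot (R.e.baseChange ℚ) R.p : ℚ_[R.p]))).valuation = R.a)
      (Dh : PAdicHeightData (R.e.baseChange ℚ) R.p) (_hDh : Dh.IsCanonical)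
      (_hreg : (padicRegulator Dh).valuation = R.b),
      (R.e.baseChange ℚ).mordellWeilRank = 2 ∧
        Finite (AddCommGroup.primaryComponent (R.e.baseChange ℚ).sha R.p) ∧ SchneiderConjecture Dh ∧
        (padicValNat R.p (Nat.card (AddCommGroup.primaryComponent (R.e.baseChange ℚ).sha R.p)) : ℤ) ≤
          R.k + 2 := by
  intro hW16 hS h26 N _ D hopt hN hLp hcoeff Dh hDh hreg
  haveI : Fact R.p.Prime := ⟨prime_of_check (check_of_checkWP h.1)⟩
  haveI := isElliptic (check_of_checkWP h.1)
  haveI := isGloballyMinimal (check_of_checkWP h.1)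
  exact w16P h.1 hW16 hS h26 D hopt hN h.2 hLp hcoeff Dh hDh hreg

end ShaRow

end Summit.BirchSwinnertonDyer.BirchSwinnertonDyer.Rank2Sha

end
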